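import Summits.Ventures.GridStability.Lyapunov.StructurePreservingFaceCycle
import Summits.Ventures.GridStability.Lyapunov.StructurePreservingPolytope
import HarnessLib

/-!
# Saddle-face (Vu–Turitsyn polytope face) branch energies: the ×2 identity, the tail lemma replacing convexity,
# and the one-dimensional dual bound on the polytope interval `|x + a| ≤ π`

Venture GRIDFUSION, G2-SCALE cell; card «idea-3 (cycle 2) / saddle-face-cycle-certificates» (HOME/IDEAS-G2.md l.192 ff,
card 22ebe20c; crit-1 GRADE PASS · NEW-COMBINATION, STATUS 2026-08-28T18:36Z) support P1 = the planner's scratch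
`HOME/idea-3/c2/Sketch.lean` (sha16 3310835ec7f822f7, rc 0) filed VERBATIM in content as §1 of this module by the cell's
typer gridfusion-lit-4 (g14); namespace renamed from `…PolytopeFaceSketch` to `…PolytopeFace`.  0 kit, 0 facts.

WHAT IT SAYS.  The tangent gap of the branch energy at `x̂` IS `branchEnergy x x̂` (`branchEnergy_sub_tangent`, gen-1
file `StructurePreservingFaceCycle.lean`), which is `≥ 0` on THE TANGENT POINT'S OWN POLYTOPE `|x + x̂| ≤ π`
(`branchEnergy_nonneg`); on the remaining sliver `π − x̂ < x ≤ π − a` (resp. `−π − a ≤ x < −π − x̂`) of the face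
programme's interval `|x + a| ≤ π` the gap is MONOTONE, so ONE endpoint value `branchEnergy (±π − a) x̂` bounds it.
Hence the polytope version of `oneDim_dual_bound` = the window version with remainder radius `2π` and one closed-form
endpoint correction per side — same `norm_num` shape, O(1) literals; and the saddle face value is EXACTLY twice the
window face value (`U(a; ±π − a) = 2·U(a; ±π/2)`), equal to Vu–Turitsyn's `vtGap a` on the relevant side.

## Contents (§1 = P1; K1 `faceBound_of_cycleCert_polytope` and K2 `IsBelowPolytopeFaces` are later rungs)
* `branchEnergy_pi_sub_eq_two_mul`, `branchEnergy_neg_pi_sub_eq_two_mul` (×2 identities),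
  `branchEnergy_pi_sub_eq_vtGap`, `branchEnergy_neg_pi_sub_eq_vtGap` [cite: VuTuritsyn2016, Appendix 9.3];
* `branchEnergy_antitone_tail`, `branchEnergy_ge_tails` (tail monotonicity / the two endpoint corrections);
* **`oneDim_dual_bound_polytope`** (the 1-D dual certificate on `|x + a| ≤ π`), `branchEnergy_neg_endpoint_nonneg`.
-/

noncomputable section

open Real Set
open Summit.Ventures.GridStability.Models.StructurePreserving
open Summit.Ventures.GridStability.Models.StructurePreserving.Params
open Literature.MathematicalPhysics.PowerSystems.ClassicalModel.LosslessSystem (vtGap)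

namespace Summit.Ventures.GridStability.Lyapunov.StructurePreserving.PolytopeFace

/-! ## §1 (P1) -/

/-! ### §1.0 The saddle face is exactly twice the window face -/

/-- **×2 IDENTITY (+ side)**: the branch energy on the Vu–Turitsyn face `σ = π − a` (the pair-potential
saddle / UEP branch of the edge) is exactly twice its value on the window face `σ = π/2`:
`U(a; π − a) = 2cos a − (π − 2a) sin a = 2·(cos a − (π/2 − a) sin a) = 2·U(a; π/2)`. [folklore] -/
theorem branchEnergy_pi_sub_eq_two_mul (a : ℝ) :
    branchEnergy (π - a) a = 2 * branchEnergy (π / 2) a := by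
  unfold branchEnergy
  rw [Real.cos_pi_sub, Real.cos_pi_div_two]
  ring

/-- **×2 IDENTITY (− side)**: `U(a; −π − a) = 2cos a + (π + 2a) sin a = 2·U(a; −π/2)`. [folklore] -/
theorem branchEnergy_neg_pi_sub_eq_two_mul (a : ℝ) :
    branchEnergy (-π - a) a = 2 * branchEnergy (-(π / 2)) a := by
  unfold branchEnergy
  have h1 : Real.cos (-π - a) = -Real.cos a := by
    rw [show -π - a = -(a + π) by ring, Real.cos_neg, Real.cos_add_pi]
  have h2 : Real.cos (-(π / 2)) = 0 := by rw [Real.cos_neg, Real.cos_pi_div_two]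
  rw [h1, h2]
  ring

/-- The (+)-face value is Vu–Turitsyn's gap for `a ≥ 0`: `U(a; π − a) = vtGap a` (so the polytope route of
record `c < min_e b_e·vtGap(a_e)` is the r = 0 truncation of the saddle-face certificate).
[cite: VuTuritsyn2016, Appendix 9.3] -/
theorem branchEnergy_pi_sub_eq_vtGap {a : ℝ} (ha : 0 ≤ a) : branchEnergy (π - a) a = vtGap a := by
  unfold branchEnergy vtGap
  rw [abs_of_nonneg ha, Real.cos_pi_sub]
  ring

/-- … and the (−)-face value is `vtGap a` for `a ≤ 0`. [cite: VuTuritsyn2016, Appendix 9.3] -/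
theorem branchEnergy_neg_pi_sub_eq_vtGap {a : ℝ} (ha : a ≤ 0) : branchEnergy (-π - a) a = vtGap a := by
  unfold branchEnergy vtGap
  have h1 : Real.cos (-π - a) = -Real.cos a := by
    rw [show -π - a = -(a + π) by ring, Real.cos_neg, Real.cos_add_pi]
  rw [abs_of_nonpos ha, h1, Real.sin_neg]
  ring

/-! ### §1.1 The tail lemma: monotonicity of the tangent gap beyond the tangent point's polytope -/

/-- **TAIL MONOTONICITY**: for a tangent point `|x̂| ≤ π/2`, the gap `x ↦ branchEnergy x x̂` is non-increasing
on `[π − x̂, 3π/2]` (its derivative `sin x − sin x̂ ≤ 0` there, as `sin x = sin(π − x)` and `π − x ≤ x̂`).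
[folklore] -/
theorem branchEnergy_antitone_tail {xh x y : ℝ} (hxh : |xh| ≤ π / 2) (hx : π - xh ≤ x) (hxy : x ≤ y)
    (hy : y ≤ 3 * π / 2) : branchEnergy y xh ≤ branchEnergy x xh := by
  have h2 := abs_le.mp hxh
  rw [branchEnergy_eq_integral, branchEnergy_eq_integral]
  have hint : ∀ u v : ℝ, IntervalIntegrable (fun β => Real.sin β - Real.sin xh) MeasureTheory.volume u v :=
    fun u v => (Real.continuous_sin.sub continuous_const).intervalIntegrable u v
  have hsplit := intervalIntegral.integral_add_adjacent_intervals (hint xh x) (hint x y)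
  have hneg : ∫ β in x..y, (Real.sin β - Real.sin xh) ≤ 0 := by
    have h0 : 0 ≤ ∫ β in x..y, (Real.sin xh - Real.sin β) := by
      refine intervalIntegral.integral_nonneg hxy fun β hβ => ?_
      have hb1 : π - xh ≤ β := le_trans hx hβ.1
      have hb2 : β ≤ 3 * π / 2 := le_trans hβ.2 hy
      have : Real.sin β ≤ Real.sin xh := by
        rw [← Real.sin_pi_sub]
        exact Real.sin_le_sin_of_le_of_le_pi_div_two (by linarith) h2.2 (by linarith)
      linarith
    have h1 : ∫ β in x..y, (Real.sin xh - Real.sin β) = -∫ β in x..y, (Real.sin β - Real.sin xh) := by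
      rw [← intervalIntegral.integral_neg]
      congr 1
      ext β
      ring
    linarith
  linarith

/-- **THE TAIL BOUND ON THE FACE PROGRAM'S INTERVAL**: for `|a| ≤ π/2`, `|x̂| ≤ π/2` and every `x` of the
closed polytope interval `|x + a| ≤ π`, the tangent gap satisfies
`min 0 (branchEnergy (π − a) x̂) + min 0 (branchEnergy (−π − a) x̂) ≤ branchEnergy x x̂`: inside the tangent
point's polytope it is `≥ 0` (`branchEnergy_nonneg`), on the (+)-sliver `π − x̂ < x ≤ π − a` it is at least its
value at `π − a` (tail monotonicity), on the (−)-sliver symmetrically (`branchEnergy_neg_neg`). [folklore] -/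
theorem branchEnergy_ge_tails {a xh x : ℝ} (ha : |a| ≤ π / 2) (hxh : |xh| ≤ π / 2) (hx : |x + a| ≤ π) :
    min 0 (branchEnergy (π - a) xh) + min 0 (branchEnergy (-π - a) xh) ≤ branchEnergy x xh := by
  have ha' := abs_le.mp ha
  have hxh' := abs_le.mp hxh
  have hx' := abs_le.mp hx
  have m1 : min 0 (branchEnergy (π - a) xh) ≤ 0 := min_le_left _ _
  have m2 : min 0 (branchEnergy (-π - a) xh) ≤ 0 := min_le_left _ _
  by_cases h1 : x + xh ≤ π
  · by_cases h2 : -π ≤ x + xh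
    · have h0 : 0 ≤ branchEnergy x xh := branchEnergy_nonneg hxh (abs_le.mpr ⟨by linarith, h1⟩)
      linarith
    · -- (−)-sliver: `−π − a ≤ x < −π − x̂`; reflect
      push Not at h2
      have hxh_neg : |(-xh)| ≤ π / 2 := by rw [abs_neg]; exact hxh
      have htail := branchEnergy_antitone_tail (xh := -xh) (x := -x) (y := π + a) hxh_neg
        (by linarith) (by linarith) (by linarith)
      -- `branchEnergy (π + a) (−x̂) = branchEnergy (−π − a) x̂`, `branchEnergy (−x) (−x̂) = branchEnergy x x̂`
      rw [show π + a = -(-π - a) by ring, branchEnergy_neg_neg, branchEnergy_neg_neg] at htail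
      have m2' : min 0 (branchEnergy (-π - a) xh) ≤ branchEnergy (-π - a) xh := min_le_right _ _
      linarith
  · -- (+)-sliver: `π − x̂ < x ≤ π − a`
    push Not at h1
    have htail := branchEnergy_antitone_tail (xh := xh) (x := x) (y := π - a) hxh
      (by linarith) (by linarith) (by linarith)
    have m1' : min 0 (branchEnergy (π - a) xh) ≤ branchEnergy (π - a) xh := min_le_right _ _
    linarith

/-! ### §1.2 The one-dimensional dual bound on the polytope interval -/

/-- **THE ONE-DIMENSIONAL DUAL BOUND ON THE POLYTOPE INTERVAL** (crit-1's kernel format, polytope version of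
`StructurePreserving.oneDim_dual_bound`): for `b ≥ 0`, `|a| ≤ π/2`, any multiplier `λ`, any tangent point
`|x̂| ≤ π/2` and any number
`ℓ ≤ b·U(a; x̂) − λx̂ − |b(sin x̂ − sin a) − λ|·(2π) + b·(min 0 U_gap(π − a; x̂) + min 0 U_gap(−π − a; x̂))`
(`U_gap(y; x̂) = branchEnergy y x̂`, closed form in `cos`, `sin` of `a`, `x̂`), EVERY `x` of the closed polytope
interval `|x + a| ≤ π` satisfies `ℓ ≤ b·U(a; x) − λx`.  (`|x − x̂| ≤ 2π` there; the tangent identity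
`branchEnergy_sub_tangent`; the tail bound `branchEnergy_ge_tails`.)  No convexity is used. [folklore] -/
theorem oneDim_dual_bound_polytope {b a lam xh ℓ x : ℝ} (hb : 0 ≤ b) (ha : |a| ≤ π / 2)
    (hxh : |xh| ≤ π / 2)
    (hℓ : ℓ ≤ b * branchEnergy xh a - lam * xh - |b * (Real.sin xh - Real.sin a) - lam| * (2 * π)
      + b * (min 0 (branchEnergy (π - a) xh) + min 0 (branchEnergy (-π - a) xh)))
    (hx : |x + a| ≤ π) : ℓ ≤ b * branchEnergy x a - lam * x := by
  have hid := branchEnergy_sub_tangent x xh a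
  have htail := mul_le_mul_of_nonneg_left (branchEnergy_ge_tails ha hxh hx) hb
  have hdist : |x - xh| ≤ 2 * π := by
    have h1 := abs_le.mp hx
    have h2 := abs_le.mp hxh
    have h3 := abs_le.mp ha
    exact abs_le.mpr ⟨by linarith, by linarith⟩
  have hrem : -(|b * (Real.sin xh - Real.sin a) - lam| * (2 * π))
      ≤ (b * (Real.sin xh - Real.sin a) - lam) * (x - xh) := by
    have h1 : |(b * (Real.sin xh - Real.sin a) - lam) * (x - xh)|
        ≤ |b * (Real.sin xh - Real.sin a) - lam| * (2 * π) := by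
      rw [abs_mul]
      exact mul_le_mul_of_nonneg_left hdist (abs_nonneg _)
    have h2 := neg_abs_le ((b * (Real.sin xh - Real.sin a) - lam) * (x - xh))
    linarith
  have hexp : b * branchEnergy x a - lam * x
      = (b * branchEnergy xh a - lam * xh) + (b * (Real.sin xh - Real.sin a) - lam) * (x - xh)
        + b * branchEnergy x xh := by
    rw [← hid]; ring
  rw [hexp]
  linarith

/-- **WINDOW TANGENT POINTS NEED NO (−)-CORRECTION WHEN `x̂ ≥ a`** (and symmetrically): if `a ≤ x̂` then
`0 ≤ branchEnergy (−π − a) x̂` — the (−)-endpoint lies in the tangent point's polytope (`|(−π − a) + x̂| ≤ π`).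
So an emitter that pushes a path branch UP (tangent point above equilibrium) checks only the (+)-endpoint, one
closed-form inequality. [folklore] -/
theorem branchEnergy_neg_endpoint_nonneg {a xh : ℝ} (ha : |a| ≤ π / 2) (hxh : |xh| ≤ π / 2) (hle : a ≤ xh) :
    0 ≤ branchEnergy (-π - a) xh := by
  have ha' := abs_le.mp ha
  have hxh' := abs_le.mp hxh
  exact branchEnergy_nonneg hxh (abs_le.mpr ⟨by linarith, by linarith⟩)

/-! ### §1.3 Smoke: the face value of a `P = 0` pendant unit (`a = 0`) is `2b` on the polytope, `b` on the window -/

example : branchEnergy (π - 0) 0 = 2 := by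
  rw [branchEnergy_pi_sub_eq_two_mul]; simp [branchEnergy]

example : branchEnergy (π / 2) 0 = 1 := by simp [branchEnergy]

end Summit.Ventures.GridStability.Lyapunov.StructurePreserving.PolytopeFace
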